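import Summits.Ventures.HodgeRepro2.T5SU11SphericalDecayAsymptotic
import Summits.Ventures.HodgeRepro2.T5SU11KernelSemiSeparable

/-!
# The kernel at the two ends: `K_λ(t, s) → −χ_λ(s)` as `t → 0⁺`, and `e^{λs} K_λ(t, s) → −φ_λ(a_t)/((λ − 1) c(2 − λ))` as `s → ∞`

On `(0, s]` the kernel is `K_λ(·, s) = −χ_λ(s) φ_λ`, and `φ_λ(a_0) = 1`, so the kernel extends continuously to the boundary
`t = 0` with the value `−χ_λ(s)` — the regularity of the Green's function at the origin. On `[t, ∞)` it is
`K_λ(t, ·) = −φ_λ(a_t) χ_λ`, so its decay in the larger variable is EXACTLY `e^{−λs}` with the explicit constant of row 4xx's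
`e^{λs} χ_λ(s) → 1/((λ − 1) c(2 − λ))`:

* `tendsto_kernel_nhdsGT_zero` — **`K_λ(t, s) → −χ_λ(s)` as `t → 0⁺`** (`s > 0` fixed);
* `kernel_eq_of_le`, `kernel_eq_of_ge` — the two explicit formulas;
* `tendsto_exp_mul_kernel_atTop` — **`e^{λs} K_λ(t, s) → −φ_λ(a_t)/((λ − 1) c(2 − λ))` as `s → ∞`** (`t > 0` fixed);
* `kernel_decay_rate` — in particular `K_λ(t, s) e^{εs} → 0` for every `ε < λ` and `K_λ(t, s) e^{λs}` stays bounded away from `0`: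
  the decay rate `λ` of the kernel in the larger variable is sharp.

Nothing is claimed about (N).

Blind lane: Mathlib + the HodgeRepro2 prefix only; no sorry; axioms ⊆ {propext, Classical.choice,
Quot.sound}.
-/

namespace Summit.Ventures.HodgeRepro2.T5SU11KernelEnds

open Filter Topology MeasureTheory
open Set (Ioi Ioc Iic Ici)
open T5SU11Cartan T5SU11SphericalFunction T5SU11SphericalBounds T5SU11SphericalContinuous T5SU11SphericalAsymptotic
  T5SU11SphericalCfun T5SU11SphericalDecay T5SU11SphericalDecayAsymptotic T5SU11RadialGreenKernel

section measure

variable [MeasurableSpace Circle] [BorelSpace Circle]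

omit [BorelSpace Circle] in
/-- `K_λ(t, s) = −χ_λ(s) φ_λ(a_t)` for `t ≤ s`. -/
theorem kernel_eq_of_le (lam : ℝ) {t s : ℝ} (hts : t ≤ s) :
    sphGreenKernel lam t s = -(sphDecay lam s * sph lam (hyp t)) := by
  unfold sphGreenKernel
  rw [greenKernel_of_ge _ _ hts]
  ring

omit [BorelSpace Circle] in
/-- `K_λ(t, s) = −φ_λ(a_s) χ_λ(t)` for `s ≤ t`. -/
theorem kernel_eq_of_ge (lam : ℝ) {t s : ℝ} (hst : s ≤ t) :
    sphGreenKernel lam t s = -(sph lam (hyp s) * sphDecay lam t) := by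
  unfold sphGreenKernel
  rw [greenKernel_of_le _ _ hst]

/-- **The kernel at the origin**: `K_λ(t, s) → −χ_λ(s)` as `t → 0⁺`, for fixed `s > 0` (`φ_λ(a_0) = 1`). -/
theorem tendsto_kernel_nhdsGT_zero (lam : ℝ) {s : ℝ} (hs : 0 < s) :
    Tendsto (fun t => sphGreenKernel lam t s) (𝓝[>] 0) (𝓝 (-sphDecay lam s)) := by
  have hφ : Tendsto (fun t => sph lam (hyp t)) (𝓝[>] 0) (𝓝 1) := by
    have h : Tendsto (fun t => sph lam (hyp t)) (𝓝[>] 0) (𝓝 (sph lam (hyp 0))) :=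
      ((continuous_sph_hyp lam).tendsto 0).mono_left (nhdsWithin_le_nhds (s := Ioi 0))
    rwa [T5SU11OneParameter.hyp_zero, sph_one] at h
  have h := (hφ.const_mul (sphDecay lam s)).neg
  rw [mul_one] at h
  refine h.congr' ?_
  filter_upwards [Ioo_mem_nhdsGT hs] with t ht
  rw [kernel_eq_of_le lam ht.2.le]

variable {lam : ℝ} (hlam : 1 < lam)

include hlam in
/-- **The exact decay of the kernel in the larger variable**: `e^{λs} K_λ(t, s) → −φ_λ(a_t)/((λ − 1) c(2 − λ))` as `s → ∞`,
for fixed `t > 0`. -/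
theorem tendsto_exp_mul_kernel_atTop (t : ℝ) :
    Tendsto (fun s => Real.exp (lam * s) * sphGreenKernel lam t s) atTop
      (𝓝 (-(sph lam (hyp t) * (1 / ((lam - 1) * cfun (2 - lam)))))) := by
  have h := ((tendsto_exp_mul_sphDecay hlam).const_mul (sph lam (hyp t))).neg
  refine h.congr' ?_
  filter_upwards [eventually_ge_atTop t] with s hs
  rw [kernel_eq_of_le lam hs]
  ring

include hlam in
/-- **The decay rate `λ` is sharp**: `e^{εs} K_λ(t, s) → 0` for every `ε < λ`, while `e^{λs} K_λ(t, s)` tends to a non-zero limit. -/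
theorem kernel_decay_rate (t : ℝ) {ε : ℝ} (hε : ε < lam) :
    Tendsto (fun s => Real.exp (ε * s) * sphGreenKernel lam t s) atTop (𝓝 0) ∧
      -(sph lam (hyp t) * (1 / ((lam - 1) * cfun (2 - lam)))) ≠ 0 := by
  constructor
  · have h1 := tendsto_exp_mul_kernel_atTop hlam t
    have h2 : Tendsto (fun s : ℝ => Real.exp (-((lam - ε) * s))) atTop (𝓝 0) :=
      Real.tendsto_exp_neg_atTop_nhds_zero.comp (tendsto_id.const_mul_atTop (by linarith))
    have h := h2.mul h1
    rw [zero_mul] at h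
    refine h.congr' (Eventually.of_forall fun s => ?_)
    simp only
    rw [← mul_assoc, ← Real.exp_add]
    ring_nf
  · have hc : 0 < cfun (2 - lam) := cfun_pos (by linarith)
    have hφ : 0 < sph lam (hyp t) := sph_hyp_pos lam t
    have : 0 < lam - 1 := by linarith
    have hpos : 0 < sph lam (hyp t) * (1 / ((lam - 1) * cfun (2 - lam))) := by positivity
    exact neg_ne_zero.mpr hpos.ne'

end measure

end Summit.Ventures.HodgeRepro2.T5SU11KernelEnds
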